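import Literature.Analysis.FluidPDE.LinearizedOseenDyadicLimit
import Literature.Analysis.FluidPDE.KNSSOseenMildDecayTools
import HarnessLib

/-!
# The nonlinear correction of Coiculescu–Palasek's perturbation step (Prop. 4.3) in forcing form:
  `w = Φ₀ - B₀(w, w) - B₀(v, w) - B₀(w, v)` with `‖w(t)‖_∞ ≤ R t^{α-1/2}`

Analysis/FluidPDE support file (definitions `nlStep`, `nlIter`, `nlIncr`, `nlLimit` and two
constants; everything else proved) for the perturbation theorem of M. P. Coiculescu, S. Palasek,
*Non-uniqueness of smooth solutions of the Navier–Stokes equations from critical data*, Invent.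
Math. 244 (2025) = arXiv:2503.14699, Prop. 4.3 (hypothesis `hB` of
`Literature.Barriers.NavierStokesRegularity.CriticalDataSmoothNonuniqueness_of_principalParts_of_perturbationThreshold`),
on top of the linear solution operator `linSol` of `LinearizedOseenDyadicLimit.lean`
(Props. 4.2–4.3, linear part).

The fixed point `w = T(w)`, `T(w) = 𝓛[F - w ⊗ w]` of Prop. 4.3 is produced by the telescoping
Picard scheme `w₀ = 0`, `w_{k+1} = w_k + δ_k`, `δ₀ = 𝓛[F]`,
`δ_{k+1} = 𝓛[-(δ_k ⊗ w_{k+1}) - (w_k ⊗ δ_k)]` — so that, by bilinearity of the Oseen–Duhamel term,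
`Σ_{k≤n} (free terms) = Φ₀ - B₀(w_n, w_n)` and no linearity of `𝓛` beyond its defining equation is
needed — in the sup norm with weight `t^{1/2-α}` ("`‖T(w)‖_X ≤ O(‖w‖_X²) + ε₁/2`",
"`‖T(w₁) - T(w₂)‖_X ≲ ‖w₁ - w₂‖_X(‖w₁‖_X + ‖w₂‖_X)`"): with `R = 2C_L N₀` and the smallness
`16 C_L² N₀ ≤ 1` (`N₀ ∝ ε₀`, the size of the residual in `Y`), `‖δ_k(t)‖ ≤ C_L N₀ 2^{-k} t^{α-1/2}`,
`‖w_k(t)‖ ≤ R t^{α-1/2}`. Main statement: `nlLimit_spec` — the limit `w` is jointly measurable,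
vanishes off `(0, T]`, obeys `‖w(t)(x)‖ ≤ R t^{α-1/2}` and solves the mild `w`-equation
`w = Φ₀ - B₀(w,w) - B₀(v,w) - B₀(w,v)` on `(0, T]`, i.e. `u = v + w` solves (NSE) in mild form
whenever `v` solves it with the residual `Φ₀` (§5 of the paper, first paragraph).

## References

* M. P. Coiculescu, S. Palasek, Invent. Math. 244 (2025) = arXiv:2503.14699: Prop. 4.3 and its
  proof (the map `T`, the space `X`, the Duhamel formula for `w`), §5 ¶1. [`CoiculescuPalasek2025`]

The second part of the file proves the translation covariance of every stage of the scheme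
(`spaceTranslate`, `nlLimit_periodic`): lattice periodicity of the inputs is inherited by `w`.
-/

noncomputable section

open MeasureTheory Set Function Filter
open _root_.Topology
open scoped ENNReal

namespace Literature.Analysis.FluidPDE

open Literature.Analysis.ODE

variable {E : Type*} [NormedAddCommGroup E] [InnerProductSpace ℝ E] [FiniteDimensional ℝ E]
  [MeasurableSpace E] [BorelSpace E]
variable {ι : Type*} [Fintype ι]

/-! ### The telescoping Picard scheme -/

/-- **One step of the telescoping Picard scheme**: from `(w_k, δ_k)` to
`(w_{k+1}, δ_{k+1}) = (w_k + δ_k, 𝓛[-(δ_k ⊗ w_{k+1}) - (w_k ⊗ δ_k)])`. [cite: CoiculescuPalasek2025, proof of Prop. 4.3] -/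
def nlStep (T : ℝ) (v : ℝ → E → E) (p : (ℝ → E → E) × (ℝ → E → E)) :
    (ℝ → E → E) × (ℝ → E → E) :=
  (p.1 + p.2, linSol T v (![-p.2, -p.1] : Fin 2 → ℝ → E → E) (![p.1 + p.2, p.2] : Fin 2 → ℝ → E → E))

/-- **The telescoping Picard scheme** `(w_k, δ_k)`: `(w₀, δ₀) = (0, 𝓛[F])`, then `nlStep`.
[cite: CoiculescuPalasek2025, proof of Prop. 4.3] -/
def nlPair (T : ℝ) (v : ℝ → E → E) (a₀ b₀ : ι → ℝ → E → E) : ℕ → (ℝ → E → E) × (ℝ → E → E)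
  | 0 => (0, linSol T v a₀ b₀)
  | k + 1 => nlStep T v (nlPair T v a₀ b₀ k)

/-- The iterates `w_k`. [cite: CoiculescuPalasek2025, proof of Prop. 4.3] -/
def nlIter (T : ℝ) (v : ℝ → E → E) (a₀ b₀ : ι → ℝ → E → E) (k : ℕ) : ℝ → E → E :=
  (nlPair T v a₀ b₀ k).1

/-- The increments `δ_k = w_{k+1} - w_k`. [cite: CoiculescuPalasek2025, proof of Prop. 4.3] -/
def nlIncr (T : ℝ) (v : ℝ → E → E) (a₀ b₀ : ι → ℝ → E → E) (k : ℕ) : ℝ → E → E :=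
  (nlPair T v a₀ b₀ k).2

/-- **The correction** `w = lim_k w_k = Σ_k δ_k`. [cite: CoiculescuPalasek2025, Prop. 4.3] -/
def nlLimit (T : ℝ) (v : ℝ → E → E) (a₀ b₀ : ι → ℝ → E → E) (t : ℝ) (x : E) : E :=
  limUnder atTop fun k => nlIter T v a₀ b₀ k t x

section Basic

variable {T : ℝ} {v : ℝ → E → E} {a₀ b₀ : ι → ℝ → E → E}

/-- `w_0 = 0`. [folklore] -/
@[simp] theorem nlIter_zero : nlIter T v a₀ b₀ 0 = 0 := rfl

/-- `δ_0 = 𝓛[pairs]`. [folklore] -/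
theorem nlIncr_zero : nlIncr T v a₀ b₀ 0 = linSol T v a₀ b₀ := rfl

/-- `w_{k+1} = w_k + δ_k`. [folklore] -/
theorem nlIter_succ (k : ℕ) : nlIter T v a₀ b₀ (k + 1) = nlIter T v a₀ b₀ k + nlIncr T v a₀ b₀ k := rfl

/-- `δ_{k+1} = 𝓛[(-δ_k, w_{k+1}), (-w_k, δ_k)]`. [folklore] -/
theorem nlIncr_succ (k : ℕ) : nlIncr T v a₀ b₀ (k + 1) =
    linSol T v (![-nlIncr T v a₀ b₀ k, -nlIter T v a₀ b₀ k] : Fin 2 → ℝ → E → E)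
      (![nlIter T v a₀ b₀ (k + 1), nlIncr T v a₀ b₀ k] : Fin 2 → ℝ → E → E) := rfl

/-- `w_k = Σ_{j<k} δ_j`. [folklore] -/
theorem nlIter_eq_sum (k : ℕ) : nlIter T v a₀ b₀ k = ∑ j ∈ Finset.range k, nlIncr T v a₀ b₀ j := by
  induction k with
  | zero => simp
  | succ k ih => rw [nlIter_succ, ih, Finset.sum_range_succ]

end Basic

/-! ### Weighted envelopes and their integrability -/

section Envelope

variable {T α : ℝ}

omit [Fintype ι] in
/-- Integrability of `(t-τ)^{-1/2} (c₁ τ^{α-1/2})(c₂ τ^{α-1/2})` on `(0, t)` for `0 < α ≤ 1`,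
`0 < t`: it equals `c₁c₂ (t-τ)^{-1/2} τ^{2α-1}`, Abel–Beta integrable. [folklore] -/
theorem integrableOn_abelKernel_mul_quad {c₁ c₂ t : ℝ} (hα : 0 < α) (ht : 0 < t) :
    IntegrableOn (fun τ => (t - τ) ^ (-(1 / 2 : ℝ)) *
      ((c₁ * τ ^ (α - 1 / 2)) * (c₂ * τ ^ (α - 1 / 2)))) (Ioo 0 t) := by
  rcases le_or_gt α (1 / 2) with hle | hgt
  · -- `2α - 1 ≤ 0`: weight `τ^{-(1-2α)}` with `1 - 2α ∈ [0, 1)`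
    have h := (setIntegral_abel_rpow_le (β := 1 - 2 * α) (by linarith) (by linarith) ht).1
    refine (h.const_mul (c₁ * c₂)).congr ?_
    refine ae_restrict_of_forall_mem measurableSet_Ioo fun τ hτ => ?_
    have e : τ ^ (α - 1 / 2) * τ ^ (α - 1 / 2) = τ ^ (-(1 - 2 * α)) := by
      rw [← Real.rpow_add hτ.1]; ring_nf
    calc c₁ * c₂ * ((t - τ) ^ (-(1 / 2 : ℝ)) * τ ^ (-(1 - 2 * α)))
        = (t - τ) ^ (-(1 / 2 : ℝ)) * (c₁ * c₂ * (τ ^ (α - 1 / 2) * τ ^ (α - 1 / 2))) := by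
          rw [e]; ring
      _ = _ := by ring
  · -- `2α - 1 > 0`: the weight is bounded by `t^{2α-1}` on `(0,t)`
    have hk : IntegrableOn (fun τ : ℝ => (t - τ) ^ (-(1 / 2 : ℝ))) (Ioo 0 t) :=
      integrableOn_sub_rpow_Ioo (by norm_num)
    have h : IntegrableOn (fun τ => (t - τ) ^ (-(1 / 2 : ℝ)) * (τ ^ (α - 1 / 2) * τ ^ (α - 1 / 2)))
        (Ioo 0 t) := by
      refine integrableOn_abelKernel_mul (M := t ^ (2 * α - 1)) ?_ fun τ hτ => ?_
      · exact ((continuousOn_id.rpow_const fun τ hτ => Or.inl hτ.1.ne').mul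
          (continuousOn_id.rpow_const fun τ hτ => Or.inl hτ.1.ne')).aestronglyMeasurable
          measurableSet_Ioo
      · have e : τ ^ (α - 1 / 2) * τ ^ (α - 1 / 2) = τ ^ (2 * α - 1) := by
          rw [← Real.rpow_add hτ.1]; ring_nf
        rw [e, abs_of_nonneg (Real.rpow_nonneg hτ.1.le _)]
        exact Real.rpow_le_rpow hτ.1.le hτ.2.le (by linarith)
    refine (h.const_mul (c₁ * c₂)).congr (Eventually.of_forall fun τ => ?_)
    ring

omit [InnerProductSpace ℝ E] [FiniteDimensional ℝ E] [BorelSpace E] in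
/-- Integrability of `(t-τ)^{-1/2} V(τ) (c τ^{α-1/2})` on `(0, t)`, `t ≤ T`, for a lacunary
coefficient (`V ≤ K₀τ^{-1/2}`): dominated by `K₀c (t-τ)^{-1/2}τ^{α-1}`. [folklore] -/
theorem integrableOn_abelKernel_mul_coeff_quad {K₀ C η : ℝ} {v : ℝ → E → E} {V : ℝ → ℝ}
    (hv : LacunaryCoeff T K₀ C η v V) (hα : 0 < α) (hα1 : α ≤ 1) {c t : ℝ} (hc : 0 ≤ c)
    (ht : t ∈ Ioc 0 T) :
    IntegrableOn (fun τ => (t - τ) ^ (-(1 / 2 : ℝ)) * (V τ * (c * τ ^ (α - 1 / 2)))) (Ioo 0 t) ∧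
    IntegrableOn (fun τ => (t - τ) ^ (-(1 / 2 : ℝ)) * ((c * τ ^ (α - 1 / 2)) * V τ)) (Ioo 0 t) := by
  have hsub : Ioo 0 t ⊆ Ioc 0 T := fun τ hτ => ⟨hτ.1, hτ.2.le.trans ht.2⟩
  have hAB := (setIntegral_abel_rpow_le (β := 1 - α) (by linarith) (by linarith) ht.1).1
  have hAB' : IntegrableOn (fun τ => (t - τ) ^ (-(1 / 2 : ℝ)) * τ ^ (α - 1)) (Ioo 0 t) :=
    hAB.congr (Eventually.of_forall fun τ => by rw [show -(1 - α) = α - 1 by ring])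
  have hdom : ∀ τ ∈ Ioo 0 t, ‖(t - τ) ^ (-(1 / 2 : ℝ)) * (V τ * (c * τ ^ (α - 1 / 2)))‖ ≤
      K₀ * c * ((t - τ) ^ (-(1 / 2 : ℝ)) * τ ^ (α - 1)) := by
    intro τ hτ
    have hk : 0 ≤ (t - τ) ^ (-(1 / 2 : ℝ)) := Real.rpow_nonneg (sub_nonneg.2 hτ.2.le) _
    have hV0 := hv.nonneg τ (hsub hτ)
    have hw0 : 0 ≤ c * τ ^ (α - 1 / 2) := mul_nonneg hc (Real.rpow_nonneg hτ.1.le _)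
    rw [norm_mul, Real.norm_of_nonneg hk, Real.norm_of_nonneg (mul_nonneg hV0 hw0)]
    have hVK : V τ ≤ K₀ * τ ^ (-(1 / 2 : ℝ)) := by
      have hk' := hv.kato τ (hsub hτ)
      rw [rpow_neg_half_eq_inv_sqrt hτ.1.le, ← div_eq_mul_inv, le_div_iff₀ (Real.sqrt_pos.2 hτ.1),
        mul_comm]
      exact hk'
    calc (t - τ) ^ (-(1 / 2 : ℝ)) * (V τ * (c * τ ^ (α - 1 / 2)))
        ≤ (t - τ) ^ (-(1 / 2 : ℝ)) * (K₀ * τ ^ (-(1 / 2 : ℝ)) * (c * τ ^ (α - 1 / 2))) :=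
          mul_le_mul_of_nonneg_left (mul_le_mul_of_nonneg_right hVK hw0) hk
      _ = K₀ * c * ((t - τ) ^ (-(1 / 2 : ℝ)) * (τ ^ (-(1 / 2 : ℝ)) * τ ^ (α - 1 / 2))) := by ring
      _ = K₀ * c * ((t - τ) ^ (-(1 / 2 : ℝ)) * τ ^ (α - 1)) := by
          rw [← Real.rpow_add hτ.1]; ring_nf
  have hm : AEStronglyMeasurable (fun τ => (t - τ) ^ (-(1 / 2 : ℝ)) * (V τ * (c * τ ^ (α - 1 / 2))))
      (volume.restrict (Ioo 0 t)) :=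
    ((measurable_sub_rpow_const t _).aestronglyMeasurable.restrict).mul
      (((hv.cont.mono hsub).aestronglyMeasurable measurableSet_Ioo).mul
        ((continuousOn_const.mul (continuousOn_id.rpow_const fun τ hτ => Or.inl hτ.1.ne')).aestronglyMeasurable
          measurableSet_Ioo))
  have h1 : IntegrableOn (fun τ => (t - τ) ^ (-(1 / 2 : ℝ)) * (V τ * (c * τ ^ (α - 1 / 2)))) (Ioo 0 t) :=
    Integrable.mono' (hAB'.const_mul _) hm (ae_restrict_of_forall_mem measurableSet_Ioo hdom)
  exact ⟨h1, h1.congr (Eventually.of_forall fun τ => by simp only [mul_comm (V τ)])⟩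

end Envelope

/-! ### The invariants of the scheme -/

section Scheme

variable {T α N₀ K₀ C η : ℝ} {a₀ b₀ : ι → ℝ → E → E} {A₀ B₀ : ι → ℝ → ℝ} {v : ℝ → E → E} {V : ℝ → ℝ}

/-- **The invariants of the telescoping scheme at stage `k`**: measurability and support of
`w_k`, `δ_k`, the bounds `‖w_k(t)‖ ≤ R(1 - 2^{-k}) t^{α-1/2}` (`R = 2C_LN₀`) and
`‖δ_k(t)‖ ≤ C_L N₀ 2^{-k} t^{α-1/2}`, and the equation of `δ_k` from time zero with its free term:
`δ₀ = Φ₀ - B₀(v,δ₀) - B₀(δ₀,v)` and, for `k ≥ 1`, free term `-(B₀(w_k,w_k) - B₀(w_{k-1},w_{k-1}))`;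
recorded cumulatively as `w_{k+1} + B₀(v,w_{k+1}) + B₀(w_{k+1},v) = Φ₀ - B₀(w_k, w_k)`. [cite: CoiculescuPalasek2025, proof of Prop. 4.3] -/
structure NLInvariant (T α N₀ K₀ C : ℝ) (v : ℝ → E → E) (a₀ b₀ : ι → ℝ → E → E) (k : ℕ) : Prop where
  meas_iter : Measurable (uncurry (nlIter T v a₀ b₀ k))
  meas_incr : Measurable (uncurry (nlIncr T v a₀ b₀ k))
  iter_zero : ∀ t, t ∉ Ioc 0 T → ∀ x, nlIter T v a₀ b₀ k t x = 0
  incr_zero : ∀ t, t ∉ Ioc 0 T → ∀ x, nlIncr T v a₀ b₀ k t x = 0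
  iter_le : ∀ t ∈ Ioc 0 T, ∀ x, ‖nlIter T v a₀ b₀ k t x‖ ≤
    2 * linSolConst E α K₀ C * N₀ * (1 - (2 : ℝ)⁻¹ ^ k) * t ^ (α - 1 / 2)
  incr_le : ∀ t ∈ Ioc 0 T, ∀ x, ‖nlIncr T v a₀ b₀ k t x‖ ≤
    linSolConst E α K₀ C * N₀ * (2 : ℝ)⁻¹ ^ k * t ^ (α - 1 / 2)
  cumulative : ∀ t ∈ Ioc 0 T, ∀ x,
    nlIter T v a₀ b₀ (k + 1) t x + oseenDuhamel 1 0 v (nlIter T v a₀ b₀ (k + 1)) t x +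
        oseenDuhamel 1 0 (nlIter T v a₀ b₀ (k + 1)) v t x =
      freeFrom a₀ b₀ 0 t x - oseenDuhamel 1 0 (nlIter T v a₀ b₀ k) (nlIter T v a₀ b₀ k) t x

/-- `w_{k+1}` is bounded by `R t^{α-1/2}` on `(0, T]` given the invariants at stage `k`. [folklore] -/
theorem NLInvariant.iter_succ_le {k : ℕ} (h : NLInvariant (E := E) T α N₀ K₀ C v a₀ b₀ k)
    {t : ℝ} (ht : t ∈ Ioc 0 T) (x : E) :
    ‖nlIter T v a₀ b₀ (k + 1) t x‖ ≤
      2 * linSolConst E α K₀ C * N₀ * (1 - (2 : ℝ)⁻¹ ^ (k + 1)) * t ^ (α - 1 / 2) := by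
  rw [nlIter_succ, Pi.add_apply, Pi.add_apply]
  have ht0 : 0 ≤ t ^ (α - 1 / 2) := (Real.rpow_pos_of_pos ht.1 _).le
  calc ‖nlIter T v a₀ b₀ k t x + nlIncr T v a₀ b₀ k t x‖
      ≤ ‖nlIter T v a₀ b₀ k t x‖ + ‖nlIncr T v a₀ b₀ k t x‖ := norm_add_le _ _
    _ ≤ 2 * linSolConst E α K₀ C * N₀ * (1 - (2 : ℝ)⁻¹ ^ k) * t ^ (α - 1 / 2) +
          linSolConst E α K₀ C * N₀ * (2 : ℝ)⁻¹ ^ k * t ^ (α - 1 / 2) :=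
        add_le_add (h.iter_le t ht x) (h.incr_le t ht x)
    _ = 2 * linSolConst E α K₀ C * N₀ * (1 - (2 : ℝ)⁻¹ ^ (k + 1)) * t ^ (α - 1 / 2) := by
        rw [pow_succ]; ring

/-- The crude bound `‖w_k(t)‖ ≤ R t^{α-1/2}`. [folklore] -/
theorem NLInvariant.iter_le_R {k : ℕ} (h : NLInvariant (E := E) T α N₀ K₀ C v a₀ b₀ k)
    (hC : 0 ≤ linSolConst E α K₀ C * N₀) {t : ℝ} (ht : t ∈ Ioc 0 T) (x : E) :
    ‖nlIter T v a₀ b₀ k t x‖ ≤ 2 * linSolConst E α K₀ C * N₀ * t ^ (α - 1 / 2) := by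
  refine (h.iter_le t ht x).trans ?_
  have ht0 : 0 ≤ t ^ (α - 1 / 2) := (Real.rpow_pos_of_pos ht.1 _).le
  have h1 : 1 - (2 : ℝ)⁻¹ ^ k ≤ 1 := by linarith [pow_nonneg (by norm_num : (0:ℝ) ≤ 2⁻¹) k]
  calc 2 * linSolConst E α K₀ C * N₀ * (1 - (2 : ℝ)⁻¹ ^ k) * t ^ (α - 1 / 2)
      ≤ 2 * linSolConst E α K₀ C * N₀ * 1 * t ^ (α - 1 / 2) :=
        mul_le_mul_of_nonneg_right (mul_le_mul_of_nonneg_left h1 (by linarith)) ht0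
    _ = _ := by ring

/-- **The forcing pairs of the next increment.** Given the invariants at stage `k`, the two pairs
`(-δ_k, w_{k+1})`, `(-w_k, δ_k)` form a `ForcingPairs` datum with
`N = 2 · R · (C_LN₀2^{-k}) · T^α` (`R = 2C_LN₀`; `τ^{2α-1} ≤ T^α τ^{α-1}` on `(0,T]`).
[cite: CoiculescuPalasek2025, proof of Prop. 4.3 ("‖w ⊗ w‖_Y ≲ ‖w‖_X²")] -/
theorem NLInvariant.forcingPairs_succ {k : ℕ} (h : NLInvariant (E := E) T α N₀ K₀ C v a₀ b₀ k)
    (h0 : ForcingPairs T α N₀ a₀ b₀ A₀ B₀) (hC : 0 ≤ linSolConst E α K₀ C) :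
    ForcingPairs T α
      (2 * (2 * linSolConst E α K₀ C * N₀) * (linSolConst E α K₀ C * N₀ * (2 : ℝ)⁻¹ ^ k) * T ^ α)
      (![-nlIncr T v a₀ b₀ k, -nlIter T v a₀ b₀ k] : Fin 2 → ℝ → E → E)
      (![nlIter T v a₀ b₀ (k + 1), nlIncr T v a₀ b₀ k] : Fin 2 → ℝ → E → E)
      (![fun τ => linSolConst E α K₀ C * N₀ * (2 : ℝ)⁻¹ ^ k * τ ^ (α - 1 / 2),
         fun τ => 2 * linSolConst E α K₀ C * N₀ * τ ^ (α - 1 / 2)] : Fin 2 → ℝ → ℝ)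
      (![fun τ => 2 * linSolConst E α K₀ C * N₀ * τ ^ (α - 1 / 2),
         fun τ => linSolConst E α K₀ C * N₀ * (2 : ℝ)⁻¹ ^ k * τ ^ (α - 1 / 2)] : Fin 2 → ℝ → ℝ) := by
  have hCN : 0 ≤ linSolConst E α K₀ C * N₀ := mul_nonneg hC h0.N_nonneg
  have hq : 0 ≤ (2 : ℝ)⁻¹ ^ k := pow_nonneg (by norm_num) k
  set D : ℝ := linSolConst E α K₀ C * N₀ * (2 : ℝ)⁻¹ ^ k with hD
  set R : ℝ := 2 * linSolConst E α K₀ C * N₀ with hR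
  have hD0 : 0 ≤ D := mul_nonneg hCN hq
  have hR0 : 0 ≤ R := by rw [hR]; linarith
  have hpowc : ContinuousOn (fun τ : ℝ => τ ^ (α - 1 / 2)) (Ioc 0 T) :=
    continuousOn_id.rpow_const fun τ hτ => Or.inl hτ.1.ne'
  refine
    { T_pos := h0.T_pos
      α_pos := h0.α_pos
      α_le := h0.α_le
      N_nonneg := by have := (Real.rpow_pos_of_pos h0.T_pos α).le; positivity
      meas_a := ?_
      meas_b := ?_
      bound_a := ?_
      bound_b := ?_
      cont_A := ?_
      cont_B := ?_
      A_nonneg := ?_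
      B_nonneg := ?_
      dom := ?_ }
  · intro i; fin_cases i
    · exact h.meas_incr.neg
    · exact h.meas_iter.neg
  · intro i; fin_cases i
    · show Measurable (uncurry (nlIter T v a₀ b₀ (k + 1)))
      rw [nlIter_succ]; exact h.meas_iter.add h.meas_incr
    · exact h.meas_incr
  · intro i τ hτ y; fin_cases i
    · show ‖(-nlIncr T v a₀ b₀ k) τ y‖ ≤ D * τ ^ (α - 1 / 2)
      rw [Pi.neg_apply, Pi.neg_apply, norm_neg]
      exact h.incr_le τ hτ y
    · show ‖(-nlIter T v a₀ b₀ k) τ y‖ ≤ R * τ ^ (α - 1 / 2)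
      rw [Pi.neg_apply, Pi.neg_apply, norm_neg]
      exact h.iter_le_R hCN hτ y
  · intro i τ hτ y; fin_cases i
    · show ‖nlIter T v a₀ b₀ (k + 1) τ y‖ ≤ R * τ ^ (α - 1 / 2)
      have := h.iter_succ_le hτ y
      refine this.trans ?_
      have h1 : 1 - (2 : ℝ)⁻¹ ^ (k + 1) ≤ 1 := by
        linarith [pow_nonneg (by norm_num : (0:ℝ) ≤ 2⁻¹) (k + 1)]
      have ht0 : 0 ≤ τ ^ (α - 1 / 2) := (Real.rpow_pos_of_pos hτ.1 _).le
      calc 2 * linSolConst E α K₀ C * N₀ * (1 - (2 : ℝ)⁻¹ ^ (k + 1)) * τ ^ (α - 1 / 2)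
          ≤ 2 * linSolConst E α K₀ C * N₀ * 1 * τ ^ (α - 1 / 2) :=
            mul_le_mul_of_nonneg_right (mul_le_mul_of_nonneg_left h1 (by linarith)) ht0
        _ = R * τ ^ (α - 1 / 2) := by rw [hR]; ring
    · show ‖nlIncr T v a₀ b₀ k τ y‖ ≤ D * τ ^ (α - 1 / 2)
      exact h.incr_le τ hτ y
  · intro i; fin_cases i
    · exact continuousOn_const.mul hpowc
    · exact continuousOn_const.mul hpowc
  · intro i; fin_cases i
    · exact continuousOn_const.mul hpowc
    · exact continuousOn_const.mul hpowc
  · intro i τ hτ; fin_cases i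
    · exact mul_nonneg hD0 (Real.rpow_pos_of_pos hτ.1 _).le
    · exact mul_nonneg hR0 (Real.rpow_pos_of_pos hτ.1 _).le
  · intro i τ hτ; fin_cases i
    · exact mul_nonneg hR0 (Real.rpow_pos_of_pos hτ.1 _).le
    · exact mul_nonneg hD0 (Real.rpow_pos_of_pos hτ.1 _).le
  · intro τ hτ
    simp only [Fin.sum_univ_two, Matrix.cons_val_zero, Matrix.cons_val_one]
    have hτα : τ ^ (α - 1 / 2) * τ ^ (α - 1 / 2) = τ ^ α * τ ^ (α - 1) := by
      rw [← Real.rpow_add hτ.1, ← Real.rpow_add hτ.1]; ring_nf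
    have hτT : τ ^ α ≤ T ^ α := Real.rpow_le_rpow hτ.1.le hτ.2 h0.α_pos.le
    have hτ1 : 0 ≤ τ ^ (α - 1) := (Real.rpow_pos_of_pos hτ.1 _).le
    calc D * τ ^ (α - 1 / 2) * (R * τ ^ (α - 1 / 2)) + R * τ ^ (α - 1 / 2) * (D * τ ^ (α - 1 / 2))
        = 2 * R * D * (τ ^ α * τ ^ (α - 1)) := by rw [← hτα]; ring
      _ ≤ 2 * R * D * (T ^ α * τ ^ (α - 1)) := by
          refine mul_le_mul_of_nonneg_left (mul_le_mul_of_nonneg_right hτT hτ1) ?_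
          positivity
      _ = 2 * R * D * T ^ α * τ ^ (α - 1) := by ring

/-- **Induction step of the scheme.** [cite: CoiculescuPalasek2025, proof of Prop. 4.3] -/
theorem NLInvariant.succ {k : ℕ} (h : NLInvariant (E := E) T α N₀ K₀ C v a₀ b₀ k)
    (h0 : ForcingPairs T α N₀ a₀ b₀ A₀ B₀) (hv : LacunaryCoeff T K₀ C η v V)
    (hε : gronwallRate E K₀ C * η ≤ α / 2) (hT1 : T ≤ 1)
    (hsmall : 16 * linSolConst E α K₀ C ^ 2 * N₀ ≤ 1) :
    NLInvariant (E := E) T α N₀ K₀ C v a₀ b₀ (k + 1) := by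
  have hC : 0 ≤ linSolConst E α K₀ C := (linSolConst_pos h0.α_pos K₀ C).le
  have hCN : 0 ≤ linSolConst E α K₀ C * N₀ := mul_nonneg hC h0.N_nonneg
  have hF := h.forcingPairs_succ h0 hC
  obtain ⟨hm, hz, hb, heq⟩ := linSol_spec hF hv hε
  -- the contraction factor: `C_L · N_{k+1} ≤ C_LN₀ 2^{-(k+1)}`
  have hTα : T ^ α ≤ 1 := Real.rpow_le_one h0.T_pos.le hT1 h0.α_pos.le
  have hfactor : linSolConst E α K₀ C *
      (2 * (2 * linSolConst E α K₀ C * N₀) * (linSolConst E α K₀ C * N₀ * (2 : ℝ)⁻¹ ^ k) * T ^ α) ≤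
      linSolConst E α K₀ C * N₀ * (2 : ℝ)⁻¹ ^ (k + 1) := by
    have hq : 0 ≤ (2 : ℝ)⁻¹ ^ k := pow_nonneg (by norm_num) k
    have h1 : linSolConst E α K₀ C * (2 * (2 * linSolConst E α K₀ C * N₀) *
        (linSolConst E α K₀ C * N₀ * (2 : ℝ)⁻¹ ^ k) * T ^ α) =
        (4 * linSolConst E α K₀ C ^ 2 * N₀ * T ^ α) * (linSolConst E α K₀ C * N₀ * (2 : ℝ)⁻¹ ^ k) := by
      ring
    rw [h1, pow_succ]
    have h2 : 4 * linSolConst E α K₀ C ^ 2 * N₀ * T ^ α ≤ 4⁻¹ := by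
      calc 4 * linSolConst E α K₀ C ^ 2 * N₀ * T ^ α ≤ 4 * linSolConst E α K₀ C ^ 2 * N₀ * 1 := by
            have : 0 ≤ 4 * linSolConst E α K₀ C ^ 2 * N₀ := by have := h0.N_nonneg; positivity
            exact mul_le_mul_of_nonneg_left hTα this
        _ ≤ 4⁻¹ := by linarith
    calc (4 * linSolConst E α K₀ C ^ 2 * N₀ * T ^ α) * (linSolConst E α K₀ C * N₀ * (2 : ℝ)⁻¹ ^ k)
        ≤ 4⁻¹ * (linSolConst E α K₀ C * N₀ * (2 : ℝ)⁻¹ ^ k) :=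
          mul_le_mul_of_nonneg_right h2 (mul_nonneg hCN hq)
      _ ≤ (2 : ℝ)⁻¹ * (linSolConst E α K₀ C * N₀ * (2 : ℝ)⁻¹ ^ k) := by
          refine mul_le_mul_of_nonneg_right (by norm_num) (mul_nonneg hCN hq)
      _ = linSolConst E α K₀ C * N₀ * ((2 : ℝ)⁻¹ ^ k * 2⁻¹) := by ring
  refine
    { meas_iter := by rw [nlIter_succ]; exact h.meas_iter.add h.meas_incr
      meas_incr := by rw [nlIncr_succ]; exact hm
      iter_zero := fun t ht x => by
        rw [nlIter_succ, Pi.add_apply, Pi.add_apply, h.iter_zero t ht x, h.incr_zero t ht x, add_zero]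
      incr_zero := fun t ht x => by rw [nlIncr_succ]; exact hz t ht x
      iter_le := fun t ht x => h.iter_succ_le ht x
      incr_le := fun t ht x => ?_
      cumulative := fun t ht x => ?_ }
  · rw [nlIncr_succ]
    refine (hb t ht x).trans ?_
    exact mul_le_mul_of_nonneg_right hfactor (Real.rpow_pos_of_pos ht.1 _).le
  · -- the cumulative identity at stage `k+1`
    have hvb : ∀ τ ∈ Ioo 0 t, ∀ y, ‖v τ y‖ ≤ V τ := fun τ hτ y => hv.bound τ ⟨hτ.1, hτ.2.le.trans ht.2⟩ y
    have hsub : Ioo 0 t ⊆ Ioc 0 T := fun τ hτ => ⟨hτ.1, hτ.2.le.trans ht.2⟩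
    set R : ℝ := 2 * linSolConst E α K₀ C * N₀ with hR
    set D : ℝ := linSolConst E α K₀ C * N₀ * (2 : ℝ)⁻¹ ^ k with hD
    set D' : ℝ := linSolConst E α K₀ C * N₀ * (2 : ℝ)⁻¹ ^ (k + 1) with hD'
    have hR0 : 0 ≤ R := by rw [hR]; linarith
    have hD0 : 0 ≤ D := mul_nonneg hCN (pow_nonneg (by norm_num) k)
    have hD'0 : 0 ≤ D' := mul_nonneg hCN (pow_nonneg (by norm_num) (k + 1))
    -- names
    set w₀ := nlIter T v a₀ b₀ k with hw₀
    set w₁ := nlIter T v a₀ b₀ (k + 1) with hw₁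
    set w₂ := nlIter T v a₀ b₀ (k + 2) with hw₂
    set δ₀ := nlIncr T v a₀ b₀ k with hδ₀
    set δ₁ := nlIncr T v a₀ b₀ (k + 1) with hδ₁
    have hw₁def : w₁ = w₀ + δ₀ := nlIter_succ k
    have hw₂def : w₂ = w₁ + δ₁ := nlIter_succ (k + 1)
    -- measurability and weighted bounds on `(0,t)`
    have hmw₀ : Measurable (uncurry w₀) := h.meas_iter
    have hmδ₀ : Measurable (uncurry δ₀) := h.meas_incr
    have hmw₁ : Measurable (uncurry w₁) := by rw [hw₁def]; exact hmw₀.add hmδ₀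
    have hmδ₁ : Measurable (uncurry δ₁) := by rw [hδ₁, nlIncr_succ]; exact hm
    have hmw₂ : Measurable (uncurry w₂) := by rw [hw₂def]; exact hmw₁.add hmδ₁
    have hbw₀ : ∀ τ ∈ Ioo 0 t, ∀ y, ‖w₀ τ y‖ ≤ R * τ ^ (α - 1 / 2) := fun τ hτ y =>
      h.iter_le_R hCN (hsub hτ) y
    have hbw₁ : ∀ τ ∈ Ioo 0 t, ∀ y, ‖w₁ τ y‖ ≤ R * τ ^ (α - 1 / 2) := fun τ hτ y => by
      refine (h.iter_succ_le (hsub hτ) y).trans ?_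
      have h1 : 1 - (2 : ℝ)⁻¹ ^ (k + 1) ≤ 1 := by
        linarith [pow_nonneg (by norm_num : (0:ℝ) ≤ 2⁻¹) (k + 1)]
      have ht0 : 0 ≤ τ ^ (α - 1 / 2) := (Real.rpow_pos_of_pos hτ.1 _).le
      calc 2 * linSolConst E α K₀ C * N₀ * (1 - (2 : ℝ)⁻¹ ^ (k + 1)) * τ ^ (α - 1 / 2)
          ≤ 2 * linSolConst E α K₀ C * N₀ * 1 * τ ^ (α - 1 / 2) :=
            mul_le_mul_of_nonneg_right (mul_le_mul_of_nonneg_left h1 (by linarith)) ht0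
        _ = R * τ ^ (α - 1 / 2) := by rw [hR]; ring
    have hbδ₁ : ∀ τ ∈ Ioo 0 t, ∀ y, ‖δ₁ τ y‖ ≤ D' * τ ^ (α - 1 / 2) := fun τ hτ y => by
      rw [hδ₁, nlIncr_succ]
      exact (hb τ (hsub hτ) y).trans
        (mul_le_mul_of_nonneg_right hfactor (Real.rpow_pos_of_pos hτ.1 _).le)
    have hbw₂ : ∀ τ ∈ Ioo 0 t, ∀ y, ‖w₂ τ y‖ ≤ (R + D') * τ ^ (α - 1 / 2) := fun τ hτ y => by
      rw [hw₂def, Pi.add_apply, Pi.add_apply, add_mul]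
      exact (norm_add_le _ _).trans (add_le_add (hbw₁ τ hτ y) (hbδ₁ τ hτ y))
    have hbδ₀ : ∀ τ ∈ Ioo 0 t, ∀ y, ‖δ₀ τ y‖ ≤ D * τ ^ (α - 1 / 2) := fun τ hτ y =>
      h.incr_le τ (hsub hτ) y
    -- envelope integrability
    have hEv := fun c (hc : 0 ≤ c) => integrableOn_abelKernel_mul_coeff_quad hv h0.α_pos h0.α_le hc ht
    have hEq := fun c₁ c₂ => integrableOn_abelKernel_mul_quad (c₁ := c₁) (c₂ := c₂) h0.α_pos ht.1
    -- the free term of `δ₁`: `B₀(-δ₀, w₁) + B₀(-w₀, δ₀) = -(B₀(w₁,w₁) - B₀(w₀,w₀))`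
    have hfree : freeFrom (![-δ₀, -w₀] : Fin 2 → ℝ → E → E) (![w₁, δ₀] : Fin 2 → ℝ → E → E) 0 t x =
        -(oseenDuhamel 1 0 w₁ w₁ t x - oseenDuhamel 1 0 w₀ w₀ t x) := by
      simp only [freeFrom, Fin.sum_univ_two, Matrix.cons_val_zero, Matrix.cons_val_one]
      have e1 : oseenDuhamel 1 0 (-δ₀) w₁ t x = -oseenDuhamel 1 0 δ₀ w₁ t x := by
        have := oseenDuhamel_sub_left_of_envelope (a := 0) (a' := δ₀) (b := w₁)
          (Ma := fun _ => 0) (Ma' := fun τ => D * τ ^ (α - 1 / 2)) (Mb := fun τ => R * τ ^ (α - 1 / 2))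
          (t₀ := 0) (t := t) measurable_const hmδ₀ hmw₁ (fun τ _ y => by simp) hbδ₀ hbw₁
          (by simp) (hEq D R) x
        rw [zero_sub] at this
        rw [this, oseenDuhamel_zero_left, Pi.zero_apply, Pi.zero_apply, zero_sub]
      have e2 : oseenDuhamel 1 0 (-w₀) δ₀ t x = -oseenDuhamel 1 0 w₀ δ₀ t x := by
        have := oseenDuhamel_sub_left_of_envelope (a := 0) (a' := w₀) (b := δ₀)
          (Ma := fun _ => 0) (Ma' := fun τ => R * τ ^ (α - 1 / 2)) (Mb := fun τ => D * τ ^ (α - 1 / 2))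
          (t₀ := 0) (t := t) measurable_const hmw₀ hmδ₀ (fun τ _ y => by simp) hbw₀ hbδ₀
          (by simp) (hEq R D) x
        rw [zero_sub] at this
        rw [this, oseenDuhamel_zero_left, Pi.zero_apply, Pi.zero_apply, zero_sub]
      -- `B₀(w₁,w₁) - B₀(w₀,w₀) = B₀(δ₀, w₁) + B₀(w₀, δ₀)` since `w₁ = w₀ + δ₀`
      have e3 : oseenDuhamel 1 0 w₁ w₁ t x =
          oseenDuhamel 1 0 w₀ w₁ t x + oseenDuhamel 1 0 δ₀ w₁ t x := by
        rw [show oseenDuhamel 1 0 w₁ w₁ t x = oseenDuhamel 1 0 (w₀ + δ₀) w₁ t x by rw [← hw₁def]]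
        exact oseenDuhamel_add_left_of_envelope hmw₀ hmδ₀ hmw₁ hbw₀ hbδ₀ hbw₁ (hEq R R) (hEq D R) x
      have e4 : oseenDuhamel 1 0 w₀ w₁ t x =
          oseenDuhamel 1 0 w₀ w₀ t x + oseenDuhamel 1 0 w₀ δ₀ t x := by
        rw [show oseenDuhamel 1 0 w₀ w₁ t x = oseenDuhamel 1 0 w₀ (w₀ + δ₀) t x by rw [← hw₁def]]
        exact oseenDuhamel_add_right_of_envelope hmw₀ hmw₀ hmδ₀ hbw₀ hbw₀ hbδ₀ (hEq R R) (hEq R D) x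
      rw [e1, e2, e3, e4]
      abel
    -- the equation of `δ₁` from `linSol_spec`
    have hδ₁eq : δ₁ t x = -(oseenDuhamel 1 0 w₁ w₁ t x - oseenDuhamel 1 0 w₀ w₀ t x) -
        oseenDuhamel 1 0 v δ₁ t x - oseenDuhamel 1 0 δ₁ v t x := by
      rw [hδ₁, nlIncr_succ, heq t ht x, ← nlIncr_succ, ← hδ₁, hfree]
    -- additivity of the `B₀(v,·)`, `B₀(·,v)` terms along `w₂ = w₁ + δ₁`
    have hA1 : oseenDuhamel 1 0 v w₂ t x = oseenDuhamel 1 0 v w₁ t x + oseenDuhamel 1 0 v δ₁ t x := by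
      rw [hw₂def]
      exact oseenDuhamel_add_right_of_envelope hv.meas hmw₁ hmδ₁ hvb hbw₁ hbδ₁
        (hEv R hR0).1 (hEv D' hD'0).1 x
    have hA2 : oseenDuhamel 1 0 w₂ v t x = oseenDuhamel 1 0 w₁ v t x + oseenDuhamel 1 0 δ₁ v t x := by
      rw [hw₂def]
      exact oseenDuhamel_add_left_of_envelope hmw₁ hmδ₁ hv.meas hbw₁ hbδ₁ hvb
        (hEv R hR0).2 (hEv D' hD'0).2 x
    have hIH := h.cumulative t ht x
    rw [← hw₀, ← hw₁] at hIH
    show w₂ t x + oseenDuhamel 1 0 v w₂ t x + oseenDuhamel 1 0 w₂ v t x =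
      freeFrom a₀ b₀ 0 t x - oseenDuhamel 1 0 w₁ w₁ t x
    rw [hA1, hA2, hw₂def, Pi.add_apply, Pi.add_apply, hδ₁eq]
    have : w₁ t x + oseenDuhamel 1 0 v w₁ t x + oseenDuhamel 1 0 w₁ v t x =
        freeFrom a₀ b₀ 0 t x - oseenDuhamel 1 0 w₀ w₀ t x := hIH
    linear_combination (norm := abel) this

/-- **Base case of the scheme.** [cite: CoiculescuPalasek2025, proof of Prop. 4.3] -/
theorem NLInvariant.zero (h0 : ForcingPairs T α N₀ a₀ b₀ A₀ B₀) (hv : LacunaryCoeff T K₀ C η v V)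
    (hε : gronwallRate E K₀ C * η ≤ α / 2) : NLInvariant (E := E) T α N₀ K₀ C v a₀ b₀ 0 := by
  obtain ⟨hm, hz, hb, heq⟩ := linSol_spec h0 hv hε
  refine
    { meas_iter := measurable_const
      meas_incr := hm
      iter_zero := fun t _ x => rfl
      incr_zero := hz
      iter_le := fun t ht x => by simp
      incr_le := fun t ht x => by
        show ‖linSol T v a₀ b₀ t x‖ ≤ _
        simpa using hb t ht x
      cumulative := fun t ht x => ?_ }
  show nlIter T v a₀ b₀ 1 t x + oseenDuhamel 1 0 v (nlIter T v a₀ b₀ 1) t x +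
      oseenDuhamel 1 0 (nlIter T v a₀ b₀ 1) v t x =
    freeFrom a₀ b₀ 0 t x - oseenDuhamel 1 0 (nlIter T v a₀ b₀ 0) (nlIter T v a₀ b₀ 0) t x
  have h1 : nlIter T v a₀ b₀ 1 = linSol T v a₀ b₀ := by
    rw [nlIter_succ, nlIter_zero, zero_add]; rfl
  rw [h1, nlIter_zero, oseenDuhamel_zero_left, heq t ht x]
  simp only [Pi.zero_apply, sub_zero]
  abel

/-- **All invariants hold.** [cite: CoiculescuPalasek2025, proof of Prop. 4.3] -/
theorem nlInvariant (h0 : ForcingPairs T α N₀ a₀ b₀ A₀ B₀) (hv : LacunaryCoeff T K₀ C η v V)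
    (hε : gronwallRate E K₀ C * η ≤ α / 2) (hT1 : T ≤ 1)
    (hsmall : 16 * linSolConst E α K₀ C ^ 2 * N₀ ≤ 1) (k : ℕ) :
    NLInvariant (E := E) T α N₀ K₀ C v a₀ b₀ k := by
  induction k with
  | zero => exact NLInvariant.zero h0 hv hε
  | succ k ih => exact ih.succ h0 hv hε hT1 hsmall

end Scheme

/-! ### The limit -/

section Limit

variable {T α N₀ K₀ C η : ℝ} {a₀ b₀ : ι → ℝ → E → E} {A₀ B₀ : ι → ℝ → ℝ} {v : ℝ → E → E} {V : ℝ → ℝ}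

/-- Distance of consecutive iterates. [folklore] -/
theorem dist_nlIter_succ_le (h0 : ForcingPairs T α N₀ a₀ b₀ A₀ B₀) (hv : LacunaryCoeff T K₀ C η v V)
    (hε : gronwallRate E K₀ C * η ≤ α / 2) (hT1 : T ≤ 1)
    (hsmall : 16 * linSolConst E α K₀ C ^ 2 * N₀ ≤ 1) (k : ℕ) (t : ℝ) (x : E) :
    dist (nlIter T v a₀ b₀ k t x) (nlIter T v a₀ b₀ (k + 1) t x) ≤
      (if t ∈ Ioc 0 T then linSolConst E α K₀ C * N₀ * t ^ (α - 1 / 2) else 0) * (2 : ℝ)⁻¹ ^ k := by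
  have h := nlInvariant h0 hv hε hT1 hsmall k
  rw [nlIter_succ, Pi.add_apply, Pi.add_apply, dist_eq_norm, sub_add_cancel_left, norm_neg]
  split_ifs with ht
  · calc ‖nlIncr T v a₀ b₀ k t x‖ ≤ linSolConst E α K₀ C * N₀ * (2 : ℝ)⁻¹ ^ k * t ^ (α - 1 / 2) :=
          h.incr_le t ht x
      _ = _ := by ring
  · rw [h.incr_zero t ht x, norm_zero, zero_mul]

/-- **Convergence of the iterates** to `nlLimit`. [cite: CoiculescuPalasek2025, proof of Prop. 4.3 (Banach fixed point)] -/
theorem tendsto_nlIter (h0 : ForcingPairs T α N₀ a₀ b₀ A₀ B₀) (hv : LacunaryCoeff T K₀ C η v V)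
    (hε : gronwallRate E K₀ C * η ≤ α / 2) (hT1 : T ≤ 1)
    (hsmall : 16 * linSolConst E α K₀ C ^ 2 * N₀ ≤ 1) (t : ℝ) (x : E) :
    Tendsto (fun k => nlIter T v a₀ b₀ k t x) atTop (𝓝 (nlLimit T v a₀ b₀ t x)) := by
  haveI : CompleteSpace E := FiniteDimensional.complete ℝ E
  have hc : CauchySeq fun k => nlIter T v a₀ b₀ k t x :=
    cauchySeq_of_le_geometric (2 : ℝ)⁻¹
      (if t ∈ Ioc 0 T then linSolConst E α K₀ C * N₀ * t ^ (α - 1 / 2) else 0) (by norm_num)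
      (dist_nlIter_succ_le h0 hv hε hT1 hsmall · t x)
  exact hc.tendsto_limUnder

/-- Rate: `‖w_k(t)(x) - w(t)(x)‖ ≤ 2 C_LN₀ t^{α-1/2} 2^{-k}` on `(0,T]`. [folklore] -/
theorem norm_nlIter_sub_nlLimit_le (h0 : ForcingPairs T α N₀ a₀ b₀ A₀ B₀) (hv : LacunaryCoeff T K₀ C η v V)
    (hε : gronwallRate E K₀ C * η ≤ α / 2) (hT1 : T ≤ 1)
    (hsmall : 16 * linSolConst E α K₀ C ^ 2 * N₀ ≤ 1) (k : ℕ) (t : ℝ) (x : E) :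
    ‖nlIter T v a₀ b₀ k t x - nlLimit T v a₀ b₀ t x‖ ≤
      (if t ∈ Ioc 0 T then linSolConst E α K₀ C * N₀ * t ^ (α - 1 / 2) else 0) * (2 : ℝ)⁻¹ ^ k /
        (1 - (2 : ℝ)⁻¹) := by
  rw [← dist_eq_norm]
  exact dist_le_of_le_geometric_of_tendsto (2 : ℝ)⁻¹
    (if t ∈ Ioc 0 T then linSolConst E α K₀ C * N₀ * t ^ (α - 1 / 2) else 0) (by norm_num)
    (dist_nlIter_succ_le h0 hv hε hT1 hsmall · t x) (tendsto_nlIter h0 hv hε hT1 hsmall t x) k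

/-- **The correction is jointly measurable.** [folklore] -/
theorem measurable_uncurry_nlLimit (h0 : ForcingPairs T α N₀ a₀ b₀ A₀ B₀) (hv : LacunaryCoeff T K₀ C η v V)
    (hε : gronwallRate E K₀ C * η ≤ α / 2) (hT1 : T ≤ 1)
    (hsmall : 16 * linSolConst E α K₀ C ^ 2 * N₀ ≤ 1) : Measurable (uncurry (nlLimit T v a₀ b₀)) := by
  refine measurable_of_tendsto_metrizable (f := fun k => uncurry (nlIter T v a₀ b₀ k))
    (fun k => (nlInvariant h0 hv hε hT1 hsmall k).meas_iter) ?_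
  rw [tendsto_pi_nhds]
  exact fun q => tendsto_nlIter h0 hv hε hT1 hsmall q.1 q.2

/-- The correction vanishes off `(0, T]`. [folklore] -/
theorem nlLimit_of_not_mem (h0 : ForcingPairs T α N₀ a₀ b₀ A₀ B₀) (hv : LacunaryCoeff T K₀ C η v V)
    (hε : gronwallRate E K₀ C * η ≤ α / 2) (hT1 : T ≤ 1)
    (hsmall : 16 * linSolConst E α K₀ C ^ 2 * N₀ ≤ 1) {t : ℝ} (ht : t ∉ Ioc 0 T) (x : E) :
    nlLimit T v a₀ b₀ t x = 0 := by
  have h := tendsto_nlIter h0 hv hε hT1 hsmall t x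
  rw [show (fun k => nlIter T v a₀ b₀ k t x) = fun _ => 0 from
    funext fun k => (nlInvariant h0 hv hε hT1 hsmall k).iter_zero t ht x] at h
  exact tendsto_nhds_unique h tendsto_const_nhds

/-- **The weighted bound of the correction**: `‖w(t)(x)‖ ≤ R t^{α-1/2}`, `R = 2C_LN₀`, on `(0,T]`
("`w ∈ B_X(0, ε₁)`", sup-norm slot). [cite: CoiculescuPalasek2025, Prop. 4.3] -/
theorem norm_nlLimit_le (h0 : ForcingPairs T α N₀ a₀ b₀ A₀ B₀) (hv : LacunaryCoeff T K₀ C η v V)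
    (hε : gronwallRate E K₀ C * η ≤ α / 2) (hT1 : T ≤ 1)
    (hsmall : 16 * linSolConst E α K₀ C ^ 2 * N₀ ≤ 1) {t : ℝ} (ht : t ∈ Ioc 0 T) (x : E) :
    ‖nlLimit T v a₀ b₀ t x‖ ≤ 2 * linSolConst E α K₀ C * N₀ * t ^ (α - 1 / 2) := by
  have hC : 0 ≤ linSolConst E α K₀ C := (linSolConst_pos h0.α_pos K₀ C).le
  have hCN : 0 ≤ linSolConst E α K₀ C * N₀ := mul_nonneg hC h0.N_nonneg
  exact le_of_tendsto ((tendsto_nlIter h0 hv hε hT1 hsmall t x).norm)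
    (Eventually.of_forall fun k => (nlInvariant h0 hv hε hT1 hsmall k).iter_le_R hCN ht x)

/-- **The correction solves the mild `w`-equation**: for `t ∈ (0, T]`,
`w(t)(x) = Φ₀(t)(x) - B₀(w,w)(t)(x) - B₀(v,w)(t)(x) - B₀(w,v)(t)(x)` (pass `k → ∞` in the
cumulative identity: dominated convergence in the slots under the envelopes `V ≤ K₀τ^{-1/2}`,
`R τ^{α-1/2}`). With `v` a mild solution up to the residual `Φ₀`, `u = v + w` is a mild solution of
(NSE) (§5 ¶1 of the paper). [cite: CoiculescuPalasek2025, Prop. 4.3 and §5 ¶1] -/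
theorem nlLimit_eq (h0 : ForcingPairs T α N₀ a₀ b₀ A₀ B₀) (hv : LacunaryCoeff T K₀ C η v V)
    (hε : gronwallRate E K₀ C * η ≤ α / 2) (hT1 : T ≤ 1)
    (hsmall : 16 * linSolConst E α K₀ C ^ 2 * N₀ ≤ 1) {t : ℝ} (ht : t ∈ Ioc 0 T) (x : E) :
    nlLimit T v a₀ b₀ t x = freeFrom a₀ b₀ 0 t x -
      oseenDuhamel 1 0 (nlLimit T v a₀ b₀) (nlLimit T v a₀ b₀) t x -
      oseenDuhamel 1 0 v (nlLimit T v a₀ b₀) t x - oseenDuhamel 1 0 (nlLimit T v a₀ b₀) v t x := by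
  set w := nlLimit T v a₀ b₀ with hw
  set W := nlIter T v a₀ b₀ with hW
  set R : ℝ := 2 * linSolConst E α K₀ C * N₀ with hR
  have hC : 0 ≤ linSolConst E α K₀ C := (linSolConst_pos h0.α_pos K₀ C).le
  have hCN : 0 ≤ linSolConst E α K₀ C * N₀ := mul_nonneg hC h0.N_nonneg
  have hR0 : 0 ≤ R := by rw [hR]; linarith
  have hsub : Ioo 0 t ⊆ Ioc 0 T := fun τ hτ => ⟨hτ.1, hτ.2.le.trans ht.2⟩
  have hvb : ∀ τ ∈ Ioo 0 t, ∀ y, ‖v τ y‖ ≤ V τ := fun τ hτ y => hv.bound τ (hsub hτ) y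
  have hInv := nlInvariant h0 hv hε hT1 hsmall
  have hWb : ∀ k, ∀ τ ∈ Ioo 0 t, ∀ y, ‖W k τ y‖ ≤ R * τ ^ (α - 1 / 2) := fun k τ hτ y =>
    (hInv k).iter_le_R hCN (hsub hτ) y
  have hmW : ∀ k, Measurable (uncurry (W k)) := fun k => (hInv k).meas_iter
  have hlim : ∀ τ y, Tendsto (fun k => W k τ y) atTop (𝓝 (w τ y)) := tendsto_nlIter h0 hv hε hT1 hsmall
  have hEv := integrableOn_abelKernel_mul_coeff_quad hv h0.α_pos h0.α_le hR0 ht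
  have hEq := integrableOn_abelKernel_mul_quad (c₁ := R) (c₂ := R) h0.α_pos ht.1
  -- the four convergences
  have hT1' : Tendsto (fun k => oseenDuhamel 1 0 v (W (k + 1)) t x) atTop (𝓝 (oseenDuhamel 1 0 v w t x)) :=
    tendsto_oseenDuhamel_of_dominated (fun _ => hv.meas) (fun k => hmW (k + 1)) (fun _ => hvb)
      (fun k => hWb (k + 1)) hEv.1 (fun τ _ y => tendsto_const_nhds)
      (fun τ _ y => (hlim τ y).comp (tendsto_add_atTop_nat 1)) x
  have hT2' : Tendsto (fun k => oseenDuhamel 1 0 (W (k + 1)) v t x) atTop (𝓝 (oseenDuhamel 1 0 w v t x)) :=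
    tendsto_oseenDuhamel_of_dominated (fun k => hmW (k + 1)) (fun _ => hv.meas) (fun k => hWb (k + 1))
      (fun _ => hvb) hEv.2 (fun τ _ y => (hlim τ y).comp (tendsto_add_atTop_nat 1))
      (fun τ _ y => tendsto_const_nhds) x
  have hT3' : Tendsto (fun k => oseenDuhamel 1 0 (W k) (W k) t x) atTop (𝓝 (oseenDuhamel 1 0 w w t x)) :=
    tendsto_oseenDuhamel_of_dominated hmW hmW hWb hWb hEq (fun τ _ y => hlim τ y)
      (fun τ _ y => hlim τ y) x
  have hT0' : Tendsto (fun k => W (k + 1) t x) atTop (𝓝 (w t x)) :=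
    (hlim t x).comp (tendsto_add_atTop_nat 1)
  -- the cumulative identity, rearranged
  have hid : ∀ k, W (k + 1) t x = freeFrom a₀ b₀ 0 t x - oseenDuhamel 1 0 (W k) (W k) t x -
      oseenDuhamel 1 0 v (W (k + 1)) t x - oseenDuhamel 1 0 (W (k + 1)) v t x := by
    intro k
    have h := (hInv k).cumulative t ht x
    rw [← hW] at h
    linear_combination (norm := abel) h
  have hrhs : Tendsto (fun k => freeFrom a₀ b₀ 0 t x - oseenDuhamel 1 0 (W k) (W k) t x -
      oseenDuhamel 1 0 v (W (k + 1)) t x - oseenDuhamel 1 0 (W (k + 1)) v t x) atTop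
      (𝓝 (freeFrom a₀ b₀ 0 t x - oseenDuhamel 1 0 w w t x - oseenDuhamel 1 0 v w t x -
        oseenDuhamel 1 0 w v t x)) :=
    ((tendsto_const_nhds.sub hT3').sub hT1').sub hT2'
  rw [show (fun k => W (k + 1) t x) = fun k => freeFrom a₀ b₀ 0 t x - oseenDuhamel 1 0 (W k) (W k) t x -
      oseenDuhamel 1 0 v (W (k + 1)) t x - oseenDuhamel 1 0 (W (k + 1)) v t x from funext hid] at hT0'
  exact tendsto_nhds_unique hT0' hrhs

/-- **The nonlinear correction of the perturbation step (Prop. 4.3 of Coiculescu–Palasek in forcing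
form, with sup norms).** Let `v` be a lacunary coefficient ((3.13a), (3.13b): `LacunaryCoeff`),
let the residual be given as forcing pairs of size `N₀` in the weight `τ^{α-1}` (`ForcingPairs`;
`N₀ ∝ ε₀ = ‖F‖_Y`), and assume `T ≤ 1`, the power-loss smallness `Λη ≤ α/2` of the lacunarity slope
(Prop. 4.2: "`A` sufficiently large depending on `ε`") and the residual smallness
`16 C_L² N₀ ≤ 1` (Prop. 4.3: "`ε₀` so small that …", the constant `C₄`). Then the correction
`w = nlLimit T v a₀ b₀` is jointly measurable, vanishes off `(0, T]`, obeys
`‖w(t)(x)‖ ≤ 2C_LN₀ t^{α-1/2}` and solves `w = Φ₀ - B₀(w,w) - B₀(v,w) - B₀(w,v)` on `(0, T]`.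
[cite: CoiculescuPalasek2025, Prop. 4.3] -/
theorem nlLimit_spec (h0 : ForcingPairs T α N₀ a₀ b₀ A₀ B₀) (hv : LacunaryCoeff T K₀ C η v V)
    (hε : gronwallRate E K₀ C * η ≤ α / 2) (hT1 : T ≤ 1)
    (hsmall : 16 * linSolConst E α K₀ C ^ 2 * N₀ ≤ 1) :
    Measurable (uncurry (nlLimit T v a₀ b₀)) ∧
    (∀ t, t ∉ Ioc 0 T → ∀ x, nlLimit T v a₀ b₀ t x = 0) ∧
    (∀ t ∈ Ioc 0 T, ∀ x, ‖nlLimit T v a₀ b₀ t x‖ ≤ 2 * linSolConst E α K₀ C * N₀ * t ^ (α - 1 / 2)) ∧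
    (∀ t ∈ Ioc 0 T, ∀ x, nlLimit T v a₀ b₀ t x = freeFrom a₀ b₀ 0 t x -
      oseenDuhamel 1 0 (nlLimit T v a₀ b₀) (nlLimit T v a₀ b₀) t x -
      oseenDuhamel 1 0 v (nlLimit T v a₀ b₀) t x - oseenDuhamel 1 0 (nlLimit T v a₀ b₀) v t x) :=
  ⟨measurable_uncurry_nlLimit h0 hv hε hT1 hsmall, fun _ ht x => nlLimit_of_not_mem h0 hv hε hT1 hsmall ht x,
    fun _ ht x => norm_nlLimit_le h0 hv hε hT1 hsmall ht x, fun _ ht x => nlLimit_eq h0 hv hε hT1 hsmall ht x⟩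

end Limit

end Literature.Analysis.FluidPDE

/-!
## Translation covariance of the correction `w = nlLimit` (periodicity is inherited)

Second part of this file (everything proved) for the perturbation step of M. P. Coiculescu,
S. Palasek, *Non-uniqueness of smooth solutions of the Navier–Stokes equations from critical data*,
Invent. Math. 244 (2025) = arXiv:2503.14699, Prop. 4.3: the correction `w` is constructed on the
torus `𝕋³`. In the tree the construction (`nlLimit`, files `LinearizedOseenWindow`,
`LinearizedOseenLayers`, `LinearizedOseenDyadicLimit`, `LacunaryOseenNonlinearCorrection`) runs on
the whole space with periodic (lifted) coefficient `v` and forcing pairs `(aᵢ, bᵢ)`; this file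
checks that every stage commutes with space translations (the Duhamel term does:
`oseenDuhamel_comp_add_right`), so that `w` is periodic whenever its inputs are:

* `linPicard_translate`, `linPicardLimit_translate`, `freeFrom_translate`, `layerSol_translate`,
  `partialSol_translate`, `linSol_translate`, `nlPair_translate`, `nlLimit_translate`;
* `nlLimit_periodic` — if `v(τ, y + c) = v(τ, y)`, `aᵢ(τ, y + c) = aᵢ(τ, y)`,
  `bᵢ(τ, y + c) = bᵢ(τ, y)` for all `τ, y`, then `w(t, x + c) = w(t, x)`.

## References

* M. P. Coiculescu, S. Palasek, Invent. Math. 244 (2025) = arXiv:2503.14699, Prop. 4.3 (the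
  construction is posed on `𝕋³`). [`CoiculescuPalasek2025`]
-/


open MeasureTheory Set Function Filter TopologicalSpace InnerProductSpace Metric
open _root_.Topology
open scoped RealInnerProductSpace NNReal ENNReal

namespace Literature.Analysis.FluidPDE

variable {E : Type*} [NormedAddCommGroup E] [InnerProductSpace ℝ E] [FiniteDimensional ℝ E]
  [MeasurableSpace E] [BorelSpace E]
variable {ι : Type*} [Fintype ι]

/-- Space translation of a time-dependent field: `(τ_c f)(t)(y) = f(t)(y + c)`. [folklore] -/
def spaceTranslate (c : E) (f : ℝ → E → E) : ℝ → E → E := fun t y => f t (y + c)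

omit [InnerProductSpace ℝ E] [FiniteDimensional ℝ E] [MeasurableSpace E] [BorelSpace E] in
/-- Unfolding `spaceTranslate`. [folklore] -/
@[simp] theorem spaceTranslate_apply (c : E) (f : ℝ → E → E) (t : ℝ) (y : E) :
    spaceTranslate c f t y = f t (y + c) := rfl

omit [InnerProductSpace ℝ E] [FiniteDimensional ℝ E] [MeasurableSpace E] [BorelSpace E] in
/-- The translate of the zero field is zero. [folklore] -/
@[simp] theorem spaceTranslate_zero_field (c : E) : spaceTranslate c (0 : ℝ → E → E) = 0 := rfl

omit [InnerProductSpace ℝ E] [FiniteDimensional ℝ E] [MeasurableSpace E] [BorelSpace E] in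
/-- Translation is additive in the field. [folklore] -/
theorem spaceTranslate_add (c : E) (f g : ℝ → E → E) :
    spaceTranslate c (f + g) = spaceTranslate c f + spaceTranslate c g := rfl

omit [InnerProductSpace ℝ E] [FiniteDimensional ℝ E] [MeasurableSpace E] [BorelSpace E] in
/-- Translation commutes with negation of the field. [folklore] -/
theorem spaceTranslate_neg (c : E) (f : ℝ → E → E) : spaceTranslate c (-f) = -spaceTranslate c f := rfl

variable (c : E)

/-- The Duhamel term commutes with space translations. [folklore] -/
theorem oseenDuhamel_spaceTranslate (t₀ : ℝ) (a b : ℝ → E → E) :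
    (fun t x => oseenDuhamel 1 t₀ (spaceTranslate c a) (spaceTranslate c b) t x) =
      spaceTranslate c fun t x => oseenDuhamel 1 t₀ a b t x := by
  funext t x
  exact oseenDuhamel_comp_add_right 1 t₀ a b c t x

/-- `linOseen` commutes with space translations. [folklore] -/
theorem linOseen_spaceTranslate (t₀ : ℝ) (v w : ℝ → E → E) :
    (fun t x => linOseen t₀ (spaceTranslate c v) (spaceTranslate c w) t x) =
      spaceTranslate c fun t x => linOseen t₀ v w t x := by
  funext t x
  simp only [linOseen, spaceTranslate_apply]
  exact congrArg₂ (· + ·) (oseenDuhamel_comp_add_right 1 t₀ v w c t x)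
    (oseenDuhamel_comp_add_right 1 t₀ w v c t x)

omit [InnerProductSpace ℝ E] [FiniteDimensional ℝ E] [MeasurableSpace E] [BorelSpace E] in
/-- `windowTrunc` commutes with space translations. [folklore] -/
theorem windowTrunc_spaceTranslate (t₀ T : ℝ) (f : ℝ → E → E) :
    windowTrunc t₀ T (spaceTranslate c f) = spaceTranslate c (windowTrunc t₀ T f) := by
  funext t x
  simp only [windowTrunc, spaceTranslate_apply]

/-- The Picard iterates commute with space translations. [folklore] -/
theorem linPicard_spaceTranslate (t₀ T : ℝ) (v Φ : ℝ → E → E) (k : ℕ) :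
    linPicard t₀ T (spaceTranslate c v) (spaceTranslate c Φ) k = spaceTranslate c (linPicard t₀ T v Φ k) := by
  induction k with
  | zero => rfl
  | succ k ih =>
    simp only [linPicard, ih]
    rw [← windowTrunc_spaceTranslate]
    congr 1
    funext t x
    simp only [spaceTranslate_apply, linOseen]
    congr 2
    · exact oseenDuhamel_comp_add_right 1 t₀ v (linPicard t₀ T v Φ k) c t x
    · exact oseenDuhamel_comp_add_right 1 t₀ (linPicard t₀ T v Φ k) v c t x

/-- The solution of the linearised window problem commutes with space translations. [folklore] -/
theorem linPicardLimit_spaceTranslate (t₀ T : ℝ) (v Φ : ℝ → E → E) :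
    linPicardLimit t₀ T (spaceTranslate c v) (spaceTranslate c Φ) =
      spaceTranslate c (linPicardLimit t₀ T v Φ) := by
  funext t x
  simp only [linPicardLimit, linPicard_spaceTranslate, spaceTranslate_apply]

/-- The free terms commute with space translations. [folklore] -/
theorem freeFrom_spaceTranslate (a b : ι → ℝ → E → E) (σ : ℝ) :
    (fun t x => freeFrom (fun i => spaceTranslate c (a i)) (fun i => spaceTranslate c (b i)) σ t x) =
      spaceTranslate c fun t x => freeFrom a b σ t x := by
  funext t x
  simp only [freeFrom, spaceTranslate_apply]
  exact Finset.sum_congr rfl fun i _ => oseenDuhamel_comp_add_right 1 σ (a i) (b i) c t x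

/-- The layer free terms commute with space translations. [folklore] -/
theorem layerFree_spaceTranslate (T : ℝ) (a b : ι → ℝ → E → E) (n : ℕ) :
    layerFree T (fun i => spaceTranslate c (a i)) (fun i => spaceTranslate c (b i)) n =
      spaceTranslate c (layerFree T a b n) := by
  unfold layerFree
  rw [← windowTrunc_spaceTranslate]
  congr 1
  funext t x
  have h1 := congrFun (congrFun (freeFrom_spaceTranslate c a b (dyadicTime T (n + 1))) t) x
  have h2 := congrFun (congrFun (freeFrom_spaceTranslate c a b (dyadicTime T n)) t) x
  simp only [spaceTranslate_apply] at h1 h2 ⊢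
  rw [h1, h2]

/-- The layer solutions commute with space translations. [folklore] -/
theorem layerSol_spaceTranslate (T : ℝ) (v : ℝ → E → E) (a b : ι → ℝ → E → E) (n : ℕ) :
    layerSol T (spaceTranslate c v) (fun i => spaceTranslate c (a i)) (fun i => spaceTranslate c (b i)) n =
      spaceTranslate c (layerSol T v a b n) := by
  unfold layerSol layerCoeff
  rw [layerFree_spaceTranslate, windowTrunc_spaceTranslate, linPicardLimit_spaceTranslate]

/-- The partial sums commute with space translations. [folklore] -/
theorem partialSol_spaceTranslate (T : ℝ) (v : ℝ → E → E) (a b : ι → ℝ → E → E) (n : ℕ) :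
    (fun t x => partialSol T (spaceTranslate c v) (fun i => spaceTranslate c (a i))
      (fun i => spaceTranslate c (b i)) n t x) = spaceTranslate c fun t x => partialSol T v a b n t x := by
  funext t x
  simp only [partialSol, layerSol_spaceTranslate, spaceTranslate_apply]

/-- The solution from time zero commutes with space translations. [folklore] -/
theorem linSol_spaceTranslate (T : ℝ) (v : ℝ → E → E) (a b : ι → ℝ → E → E) :
    linSol T (spaceTranslate c v) (fun i => spaceTranslate c (a i)) (fun i => spaceTranslate c (b i)) =
      spaceTranslate c (linSol T v a b) := by
  funext t x
  have h := fun n => congrFun (congrFun (partialSol_spaceTranslate c T v a b n) t) x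
  simp only [spaceTranslate_apply] at h
  simp only [linSol, spaceTranslate_apply, h]

/-- The telescoping scheme commutes with space translations. [folklore] -/
theorem nlPair_spaceTranslate (T : ℝ) (v : ℝ → E → E) (a₀ b₀ : ι → ℝ → E → E) (k : ℕ) :
    nlPair T (spaceTranslate c v) (fun i => spaceTranslate c (a₀ i)) (fun i => spaceTranslate c (b₀ i)) k =
      (spaceTranslate c (nlPair T v a₀ b₀ k).1, spaceTranslate c (nlPair T v a₀ b₀ k).2) := by
  induction k with
  | zero =>
    simp only [nlPair, linSol_spaceTranslate, spaceTranslate_zero_field]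
  | succ k ih =>
    simp only [nlPair, ih, nlStep]
    refine Prod.ext rfl ?_
    have hneg : (![-spaceTranslate c (nlPair T v a₀ b₀ k).2, -spaceTranslate c (nlPair T v a₀ b₀ k).1] :
        Fin 2 → ℝ → E → E) = fun i => spaceTranslate c
          ((![-(nlPair T v a₀ b₀ k).2, -(nlPair T v a₀ b₀ k).1] : Fin 2 → ℝ → E → E) i) := by
      funext i
      fin_cases i <;> rfl
    have hpos : (![spaceTranslate c (nlPair T v a₀ b₀ k).1 + spaceTranslate c (nlPair T v a₀ b₀ k).2,
        spaceTranslate c (nlPair T v a₀ b₀ k).2] : Fin 2 → ℝ → E → E) = fun i => spaceTranslate c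
          ((![(nlPair T v a₀ b₀ k).1 + (nlPair T v a₀ b₀ k).2, (nlPair T v a₀ b₀ k).2] :
            Fin 2 → ℝ → E → E) i) := by
      funext i
      fin_cases i <;> rfl
    simp only [hneg, hpos, linSol_spaceTranslate]

/-- **The correction commutes with space translations.** [folklore] -/
theorem nlLimit_spaceTranslate (T : ℝ) (v : ℝ → E → E) (a₀ b₀ : ι → ℝ → E → E) :
    nlLimit T (spaceTranslate c v) (fun i => spaceTranslate c (a₀ i)) (fun i => spaceTranslate c (b₀ i)) =
      spaceTranslate c (nlLimit T v a₀ b₀) := by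
  funext t x
  simp only [nlLimit, nlIter, nlPair_spaceTranslate, spaceTranslate_apply]

/-- **The correction of periodic inputs is periodic**: if the coefficient `v` and the forcing
pairs are invariant under the space translation by `c`, so is `w = nlLimit` (the construction of
Prop. 4.3 on `𝕋³`, run on periodic lifts). [cite: CoiculescuPalasek2025, Prop. 4.3] -/
theorem nlLimit_periodic {T : ℝ} {v : ℝ → E → E} {a₀ b₀ : ι → ℝ → E → E}
    (hv : ∀ τ y, v τ (y + c) = v τ y) (ha : ∀ i τ y, a₀ i τ (y + c) = a₀ i τ y)
    (hb : ∀ i τ y, b₀ i τ (y + c) = b₀ i τ y) (t : ℝ) (x : E) :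
    nlLimit T v a₀ b₀ t (x + c) = nlLimit T v a₀ b₀ t x := by
  have hv' : spaceTranslate c v = v := funext fun τ => funext fun y => hv τ y
  have ha' : (fun i => spaceTranslate c (a₀ i)) = a₀ :=
    funext fun i => funext fun τ => funext fun y => ha i τ y
  have hb' : (fun i => spaceTranslate c (b₀ i)) = b₀ :=
    funext fun i => funext fun τ => funext fun y => hb i τ y
  have h := nlLimit_spaceTranslate c T v a₀ b₀
  rw [hv', ha', hb'] at h
  have h2 := congrFun (congrFun h t) x
  rw [spaceTranslate_apply] at h2
  exact h2.symm

end Literature.Analysis.FluidPDE
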